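import Literature.Analysis.FluidPDE.TypeIAncientMild
import Literature.Analysis.FluidPDE.LinearizedOseenWindow
import Literature.Analysis.FluidPDE.KatoLocalBoundedContinuity
import Literature.Analysis.FluidPDE.AncientMildDrift
import Literature.Analysis.FluidPDE.MildSolutionProofs
import Literature.Analysis.FluidPDE.OseenDuhamelJointContinuity
import Literature.Analysis.FluidPDE.LongLivedOseenSolution
import Literature.Analysis.Calculus.QuadraticSolutionMapInvariant
import Literature.Analysis.FluidPDE.OseenDuhamelRadialDecay
import Literature.Analysis.FluidPDE.HeatExtensionVanishingAtInfinity
import Literature.Analysis.UnboundedOperators.HeatLiouville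
import Literature.Analysis.FluidPDE.SolenoidalCZeroSpace
import Literature.Analysis.FluidPDE.SolenoidalL2Duality
import Literature.Analysis.FluidPDE.MildSolutionHeatFlowProofs
import Literature.Analysis.UnboundedOperators.HeatKernelBoundedData
import Mathlib.Topology.ContinuousMap.Bounded.Normed
import HarnessLib

/-!
# Sup-norm perturbation theory of the Oseen integral equation on a time slab, I:
  bounded continuous slab fields, the heat operator

Analysis/FluidPDE file (definitions `slabPhys`, `slabMk`, `slabHeat`; everything else proved, no
named facts).  First of four files setting up the perturbation theory, in SUP NORM, of the
Oseen (Koch–Nadirashvili–Seregin–Šverák) integral form of Navier–Stokes,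
`v(t) = e^{(t-a)Δ} v(a) − B_a(v, v)(t)` (`B_a = oseenDuhamel 1 a`), around a bounded continuous
background on a closed time slab `[a, b]`: the state space is the Banach space
`([a, b] × E) →ᵇ E` of bounded continuous space–time fields (Mathlib's
`BoundedContinuousFunction`, sup norm).  Here:

* `slabPhys hab W` — the physical field `ℝ → E → E` of a slab field (the field on the slab,
  `0` off it), its linearity, sup bound, joint continuity on the slab and joint measurability;
* `slabMk` — the constructor from a field jointly continuous and bounded on the slab;
* `slabHeat` — the heat operator `g ↦ ((t, x) ↦ e^{(t-a)Δ} g(x))` from bounded continuous data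
  to slab fields, a bounded operator of norm `≤ 1` (Evans, §2.3.1);
* `oseenDuhamel_smul_left/right` — scalars through the Duhamel term.

## References

* G. Koch, N. Nadirashvili, G. Seregin, V. Šverák, *Liouville theorems for the Navier–Stokes
  equations and applications*, Acta Math. 203 (2009) = arXiv:0709.3599, §4 (4.3)–(4.4)
  (`u = U + B(u,u)` solved on `L^∞` by a fixed point; `‖B(u,v)‖ ≤ C√T‖u‖‖v‖`).
  [KochNadirashviliSereginSverak2009]
* M. P. Coiculescu, S. Palasek, Invent. Math. 244 (2025) = arXiv:2503.14699, App. B, Prop. B.1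
  (the linearised problem in the exponentially weighted sup norm). [CoiculescuPalasek2025]
* D. Henry, *Geometric Theory of Semilinear Parabolic Equations*, LNM 840 (1981), §3.3–3.4
  (differentiable dependence on the data). [Henry1981]
-/

noncomputable section

open MeasureTheory Set Function Filter
open _root_.Topology
open scoped BoundedContinuousFunction

namespace Literature.Analysis.FluidPDE

variable {E : Type*} [NormedAddCommGroup E] [InnerProductSpace ℝ E] [FiniteDimensional ℝ E]
  [MeasurableSpace E] [BorelSpace E]

/-! ### Bounded continuous fields on a closed time slab -/

section Slab

variable {V : Type*} [NormedAddCommGroup V] [MeasurableSpace V] [BorelSpace V]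
variable {a b : ℝ}

/-- The **physical field** of a bounded continuous field `W` on the closed slab `[a, b] × E`:
`W` itself (read through the clamp `projIcc a b`) at slab times, and `0` at all other times
(so that Duhamel integrals `∫_{(a,t)}` only see the slab values). [folklore] -/
def slabPhys (hab : a ≤ b) (W : (Icc a b) × V →ᵇ V) (t : ℝ) (x : V) : V :=
  (Icc a b).indicator (fun τ => W (projIcc a b hab τ, x)) t

variable (hab : a ≤ b)

omit [MeasurableSpace V] [BorelSpace V] in
/-- At slab times the physical field is the slab field. [folklore] -/
theorem slabPhys_of_mem (W : (Icc a b) × V →ᵇ V) {t : ℝ} (ht : t ∈ Icc a b) (x : V) :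
    slabPhys hab W t x = W (⟨t, ht⟩, x) := by
  rw [slabPhys, indicator_of_mem ht, projIcc_of_mem hab ht]

omit [MeasurableSpace V] [BorelSpace V] in
/-- Off the slab the physical field vanishes. [folklore] -/
theorem slabPhys_of_not_mem (W : (Icc a b) × V →ᵇ V) {t : ℝ} (ht : t ∉ Icc a b) (x : V) :
    slabPhys hab W t x = 0 := by
  rw [slabPhys, indicator_of_notMem ht]

omit [MeasurableSpace V] [BorelSpace V] in
/-- The physical field at a slab point `p`. [folklore] -/
theorem slabPhys_apply_coe (W : (Icc a b) × V →ᵇ V) (p : (Icc a b) × V) :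
    slabPhys hab W p.1 p.2 = W p := by
  rw [slabPhys_of_mem hab W p.1.2]

omit [MeasurableSpace V] [BorelSpace V] in
/-- Sup bound of the physical field by the norm of the slab field. [folklore] -/
theorem norm_slabPhys_le (W : (Icc a b) × V →ᵇ V) (t : ℝ) (x : V) :
    ‖slabPhys hab W t x‖ ≤ ‖W‖ := by
  by_cases ht : t ∈ Icc a b
  · rw [slabPhys_of_mem hab W ht]; exact W.norm_coe_le_norm _
  · rw [slabPhys_of_not_mem hab W ht, norm_zero]; exact norm_nonneg _

omit [MeasurableSpace V] [BorelSpace V] in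
/-- The physical field is linear in the slab field: additivity. [folklore] -/
theorem slabPhys_add (W W' : (Icc a b) × V →ᵇ V) :
    slabPhys hab (W + W') = slabPhys hab W + slabPhys hab W' := by
  funext t x
  by_cases ht : t ∈ Icc a b
  · simp only [Pi.add_apply, slabPhys_of_mem hab _ ht, BoundedContinuousFunction.coe_add]
  · simp only [Pi.add_apply, slabPhys_of_not_mem hab _ ht, add_zero]

omit [MeasurableSpace V] [BorelSpace V] in
/-- The physical field is linear in the slab field: homogeneity. [folklore] -/
theorem slabPhys_smul [NormedSpace ℝ V] (r : ℝ) (W : (Icc a b) × V →ᵇ V) :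
    slabPhys hab (r • W) = r • slabPhys hab W := by
  funext t x
  by_cases ht : t ∈ Icc a b
  · simp only [Pi.smul_apply, slabPhys_of_mem hab _ ht, BoundedContinuousFunction.coe_smul]
  · simp only [Pi.smul_apply, slabPhys_of_not_mem hab _ ht, smul_zero]

omit [MeasurableSpace V] [BorelSpace V] in
/-- The physical field is linear in the slab field: subtraction. [folklore] -/
theorem slabPhys_sub [NormedSpace ℝ V] (W W' : (Icc a b) × V →ᵇ V) :
    slabPhys hab (W - W') = slabPhys hab W - slabPhys hab W' := by
  rw [sub_eq_add_neg, slabPhys_add, ← neg_one_smul ℝ W', slabPhys_smul]; simp [sub_eq_add_neg]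

omit [MeasurableSpace V] [BorelSpace V] in
/-- The clamped field `(t, x) ↦ W (projIcc t, x)` is continuous on `ℝ × E`. [folklore] -/
theorem continuous_uncurry_projIcc (W : (Icc a b) × V →ᵇ V) :
    Continuous (uncurry fun (t : ℝ) (x : V) => W (projIcc a b hab t, x)) :=
  W.continuous.comp ((continuous_projIcc).comp continuous_fst |>.prodMk continuous_snd)

omit [MeasurableSpace V] [BorelSpace V] in
/-- The physical field is jointly continuous on the closed slab. [folklore] -/
theorem continuousOn_uncurry_slabPhys (W : (Icc a b) × V →ᵇ V) :
    ContinuousOn (uncurry (slabPhys hab W)) (Icc a b ×ˢ univ) := by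
  refine (continuous_uncurry_projIcc hab W).continuousOn.congr ?_
  rintro ⟨t, x⟩ ⟨ht, -⟩
  simp [uncurry, slabPhys, indicator_of_mem ht]

/-- The physical field is jointly measurable. [folklore] -/
theorem measurable_uncurry_slabPhys [SecondCountableTopology V] (W : (Icc a b) × V →ᵇ V) :
    Measurable (uncurry (slabPhys hab W)) := by
  have h1 : Measurable (uncurry fun (t : ℝ) (x : V) => W (projIcc a b hab t, x)) :=
    (continuous_uncurry_projIcc hab W).measurable
  have hs : MeasurableSet ((Icc a b) ×ˢ (univ : Set V) : Set (ℝ × V)) :=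
    measurableSet_Icc.prod MeasurableSet.univ
  have heq : uncurry (slabPhys hab W) =
      ((Icc a b) ×ˢ (univ : Set V)).indicator (uncurry fun t x => W (projIcc a b hab t, x)) := by
    funext p
    obtain ⟨t, x⟩ := p
    simp only [uncurry, slabPhys, Set.indicator_apply, Set.mem_prod, Set.mem_univ, and_true]
  rw [heq]
  exact h1.indicator hs

/-- Joint a.e.-strong measurability of the physical field on any restricted measure. [folklore] -/
theorem aestronglyMeasurable_uncurry_slabPhys [SecondCountableTopology V] (W : (Icc a b) × V →ᵇ V)
    (μ : Measure (ℝ × V)) :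
    AEStronglyMeasurable (uncurry (slabPhys hab W)) μ :=
  (measurable_uncurry_slabPhys hab W).aestronglyMeasurable

/-- **Constructor**: a field `F` on `ℝ × E` which is jointly continuous on the closed slab and
bounded there by `C` defines a bounded continuous slab field. [folklore] -/
def slabMk (F : ℝ → V → V) (hF : ContinuousOn (uncurry F) (Icc a b ×ˢ univ)) (C : ℝ)
    (hC : ∀ t ∈ Icc a b, ∀ x, ‖F t x‖ ≤ C) : (Icc a b) × V →ᵇ V :=
  BoundedContinuousFunction.ofNormedAddCommGroup (fun p : (Icc a b) × V => F p.1 p.2)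
    (by
      have hι : Continuous fun p : (Icc a b) × V => ((p.1 : ℝ), p.2) :=
        (continuous_subtype_val.comp continuous_fst).prodMk continuous_snd
      have := hF.comp_continuous hι (fun p => ⟨p.1.2, mem_univ _⟩)
      simpa [uncurry, Function.comp_def] using this)
    C (fun p => hC p.1 p.1.2 p.2)

omit [MeasurableSpace V] [BorelSpace V] hab in
/-- Values of the constructed slab field. [folklore] -/
@[simp]
theorem slabMk_apply (F : ℝ → V → V) (hF : ContinuousOn (uncurry F) (Icc a b ×ˢ univ)) (C : ℝ)
    (hC : ∀ t ∈ Icc a b, ∀ x, ‖F t x‖ ≤ C) (p : (Icc a b) × V) :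
    slabMk F hF C hC p = F p.1 p.2 := rfl

omit [MeasurableSpace V] [BorelSpace V] in
/-- The physical field of the constructed slab field agrees with `F` on the slab. [folklore] -/
theorem slabPhys_slabMk (F : ℝ → V → V) (hF : ContinuousOn (uncurry F) (Icc a b ×ˢ univ))
    (C : ℝ) (hC : ∀ t ∈ Icc a b, ∀ x, ‖F t x‖ ≤ C) {t : ℝ} (ht : t ∈ Icc a b) (x : V) :
    slabPhys hab (slabMk F hF C hC) t x = F t x := by
  rw [slabPhys_of_mem hab _ ht, slabMk_apply]

omit [MeasurableSpace V] [BorelSpace V] hab in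
/-- Norm bound of the constructed slab field. [folklore] -/
theorem norm_slabMk_le (F : ℝ → V → V) (hF : ContinuousOn (uncurry F) (Icc a b ×ˢ univ))
    {C : ℝ} (hC0 : 0 ≤ C) (hC : ∀ t ∈ Icc a b, ∀ x, ‖F t x‖ ≤ C) :
    ‖slabMk F hF C hC‖ ≤ C :=
  BoundedContinuousFunction.norm_ofNormedAddCommGroup_le _ hC0 _

end Slab

/-! ### The heat operator from data to slab fields -/

section Heat

variable {a b : ℝ} (hab : a ≤ b)

/-- The free evolution `(t, x) ↦ e^{(t-a)Δ} g (x)` of bounded continuous data `g` is jointly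
continuous on `ℝ × E` (Evans, §2.3.1 Thm. 1 (iii), via `continuous_uncurry_heatFlow`). [folklore] -/
theorem continuous_uncurry_heatFlow_sub (g : E →ᵇ E) :
    Continuous (uncurry fun (t : ℝ) (x : E) => heatFlow (⇑g) (t - a) x) := by
  have h := continuous_uncurry_heatFlow g.continuous (C := ‖g‖) (fun z => g.norm_coe_le_norm z)
  exact h.comp ((continuous_fst.sub continuous_const).prodMk continuous_snd)

/-- **The heat operator** `g ↦ ((t, x) ↦ e^{(t-a)Δ} g (x))` from bounded continuous data to
bounded continuous fields on the slab `[a, b] × E`: linear (`heatFlow_add_of_bound`,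
`heatFlow_const_smul`) and of norm `≤ 1` (maximum principle `norm_heatFlow_le`). [folklore] -/
def slabHeat : (E →ᵇ E) →L[ℝ] ((Icc a b) × E →ᵇ E) :=
  LinearMap.mkContinuous
    { toFun := fun g => slabMk (fun t x => heatFlow (⇑g) (t - a) x)
        (continuous_uncurry_heatFlow_sub g).continuousOn ‖g‖
        (fun t _ x => norm_heatFlow_le (fun z => g.norm_coe_le_norm z) _ _)
      map_add' := fun g h => by
        ext p
        simp only [slabMk_apply, BoundedContinuousFunction.coe_add, Pi.add_apply]
        exact heatFlow_add_of_bound g.continuous h.continuous (fun z => g.norm_coe_le_norm z)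
          (fun z => h.norm_coe_le_norm z) _ _
      map_smul' := fun r g => by
        ext p
        simp only [slabMk_apply, BoundedContinuousFunction.coe_smul, RingHom.id_apply]
        exact heatFlow_const_smul r (⇑g) _ _ }
    1 (fun g => by
      rw [one_mul]
      exact norm_slabMk_le _ _ (norm_nonneg g) _)

/-- Values of the heat operator. [folklore] -/
@[simp]
theorem slabHeat_apply (g : E →ᵇ E) (p : (Icc a b) × E) :
    slabHeat (a := a) (b := b) g p = heatFlow (⇑g) (p.1 - a) p.2 := rfl

/-- Physical field of the heat operator on the slab. [folklore] -/
theorem slabPhys_slabHeat (g : E →ᵇ E) {t : ℝ} (ht : t ∈ Icc a b) (x : E) :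
    slabPhys hab (slabHeat g) t x = heatFlow (⇑g) (t - a) x := by
  rw [slabPhys_of_mem hab _ ht, slabHeat_apply]

/-- The heat operator has norm at most `1`. [folklore] -/
theorem norm_slabHeat_le : ‖(slabHeat : (E →ᵇ E) →L[ℝ] ((Icc a b) × E →ᵇ E))‖ ≤ 1 :=
  LinearMap.mkContinuous_norm_le _ zero_le_one _

end Heat

/-! ### Scalar multiples through the Duhamel term -/

section Smul

/-- `B^ν_s(r • a, b) = r • B^ν_s(a, b)` (no integrability needed: the kernel is linear in each
slot and the Bochner integral commutes with scalars). [folklore] -/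
theorem oseenDuhamel_smul_left (ν s : ℝ) (r : ℝ) (a b : ℝ → E → E) (t : ℝ) (x : E) :
    oseenDuhamel ν s (r • a) b t x = r • oseenDuhamel ν s a b t x := by
  simp only [oseenDuhamel_apply, Pi.smul_apply, oseenKernel_smul_left, integral_smul]

/-- `B^ν_s(a, r • b) = r • B^ν_s(a, b)`. [folklore] -/
theorem oseenDuhamel_smul_right (ν s : ℝ) (r : ℝ) (a b : ℝ → E → E) (t : ℝ) (x : E) :
    oseenDuhamel ν s a (r • b) t x = r • oseenDuhamel ν s a b t x := by
  simp only [oseenDuhamel_apply, Pi.smul_apply, oseenKernel_smul_right, integral_smul]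

end Smul

end Literature.Analysis.FluidPDE

end
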